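import Summits.QuantumFields.QCD.Theorems.RobustYangMills.Negative.GlobalActivity

/-!
# `RobustYangMills` — negative-side support II: reflection positivity of the global witnesses;
# the `SU(3)` plaquette at `β = 0` and at strong coupling

Second extract of `Summits/QuantumFields/QCD/Cruxes/RobustYangMills/Disproof.lean` (item
stmt-QuantumFields-13897); builds on `Negative/GlobalActivity.lean`.

* §0c `isReflectionPositive_zero_odd`: D1-format reflection positivity of `W ≡ 0` on odd tori
  (tree `wilsonExpectation_oddReflectionPositive`, PROVED there).
* §2 (h2) for `globalPert … gOne` and `globalPert … gMix` (`isReflectionPositive_one/_mix`) and their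
  connected correlations in terms of Wilson integrals (`connectedCorr_one/_mix`).
* §3 `G = SU(3)`: the plaquette species `P01`; `⟨P⟩_0 = 0` (`integral_P01_zero`, centre twist);
  `⟨P⟩_{β₁, 2S+1} ≥ m₀ > 0` uniformly in `S` for a small `β₁ > 0`
  (`exists_plaquette_mean_lower_bound`, tree `wilsonExpectation_plaquette_ge`).
-/

noncomputable section

open MeasureTheory Filter Topology
open scoped ENNReal ComplexOrder
open Literature.MathematicalPhysics.QuantumLattice Literature.MathematicalPhysics.AQFT
  Literature.MathematicalPhysics.QuantumFieldTheory

namespace Summit.QuantumFields.QCD.Theorems.RobustYangMills.Negative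

/-! ## §0c Odd-torus reflection positivity of the unperturbed theory in D1's format -/

section OddRP

variable {G : Type*} [Group G] [TopologicalSpace G] [IsTopologicalGroup G] [CompactSpace G]
  [MeasurableSpace G] [BorelSpace G] {N : ℕ} (ρ : G →* Matrix (Fin N) (Fin N) ℂ)

omit [Group G] [TopologicalSpace G] [IsTopologicalGroup G] [CompactSpace G] [MeasurableSpace G]
  [BorelSpace G] in
/-- A positive-time observable (Wave 0's `IsPositiveTimeObservable`) depends only on the links
`P ∪ M` of the odd-torus reflection-positivity theorem. [folklore] -/
theorem dependsOn_of_isPositiveTimeObservable {d L : ℕ} [NeZero d] [NeZero L] {α : Type*}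
    {F : GaugeConfig d L G → α} (hF : IsPositiveTimeObservable F) :
    DependsOn F ((WilsonOddRP.oPosEdges ∪ WilsonOddRP.oSharedEdges : Finset (Edge d L)) :
      Set (Edge d L)) := by
  intro U V hUV
  refine hF U V fun e h1 h2 _ _ => hUV e ?_
  rw [Finset.coe_union]
  exact Or.inl (Finset.mem_coe.2 (WilsonOddRP.mem_oPosEdges.2 (show WilsonOddRP.IsOPosEdge e from ⟨h1, h2⟩)))

/-- Osterwalder–Seiler positivity of `⟨conj F(ΘU) F(U)⟩_{2S+1, β}`, `β ≥ 0`, `S ≥ 1`. [folklore] -/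
theorem wilsonExpectation_oddRP {S : ℕ} (hS : 1 ≤ S) (hρ : Continuous ρ) {β : ℝ} (hβ : 0 ≤ β)
    (F : GaugeConfig 4 (2 * S + 1) G → ℂ) (hF : Measurable F) (hFb : ∃ C : ℝ, ∀ U, ‖F U‖ ≤ C)
    (hFpos : IsPositiveTimeObservable F) :
    0 ≤ wilsonExpectation (d := 4) (L := 2 * S + 1) ρ β fun U =>
      (starRingEnd ℂ) (F U.timeReflect) * F U :=
  wilsonExpectation_oddReflectionPositive ρ ⟨S, by ring⟩ (by omega) hρ hβ F hF hFb
    (dependsOn_of_isPositiveTimeObservable hFpos)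

/-- `W ≡ 0` is reflection positive in D1's sense on every odd torus `2S+1`, `S ≥ 1`, `β ≥ 0`. [folklore] -/
theorem isReflectionPositive_zero_odd {S : ℕ} (hS : 1 ≤ S) (hρ : Continuous ρ) {β : ℝ}
    (hβ : 0 ≤ β) (b : ℕ) :
    (0 : QuasiLocalGaugePerturbation 4 (2 * S + 1) G b).IsReflectionPositive ρ β := by
  intro F hF hFb hFpos
  rw [QuasiLocalGaugePerturbation.expectation_zero]
  exact wilsonExpectation_oddRP ρ hS hρ hβ F hF hFb hFpos

/-- On the one-site torus (`S = 0`) every positive-time observable is constant, so `W ≡ 0` is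
reflection positive there for trivial reasons. [folklore] -/
theorem isReflectionPositive_zero_one (hρ : Continuous ρ) (β : ℝ) (b : ℕ) :
    (0 : QuasiLocalGaugePerturbation 4 (2 * 0 + 1) G b).IsReflectionPositive ρ β := by
  intro F hF hFb hFpos
  have hconst : ∀ U V : GaugeConfig 4 (2 * 0 + 1) G, F U = F V := fun U V =>
    hFpos U V fun e h1 h2 _ _ => by omega
  rw [QuasiLocalGaugePerturbation.expectation_zero]
  unfold wilsonExpectation
  have hfun : (fun U : GaugeConfig 4 (2 * 0 + 1) G => (starRingEnd ℂ) (F U.timeReflect) * F U) =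
      fun _ => (starRingEnd ℂ) (F 1) * F 1 := by
    funext U; rw [hconst U.timeReflect 1, hconst U 1]
  haveI := isProbabilityMeasure_wilsonMeasure (d := 4) (L := 2 * 0 + 1) ρ hρ β
  rw [hfun, integral_const, probReal_univ, one_smul]
  exact star_mul_self_nonneg (F 1)

/-- **`W ≡ 0` is reflection positive in D1's sense on EVERY odd torus `2S+1`, `β ≥ 0`** — this
discharges the hypothesis `hRP` of the tree's
`SeaFactorisationBridge.Negative.yangMillsSU3_of_robustYangMills`, which thereby becomes
unconditional. [folklore] -/
theorem isReflectionPositive_zero_all (hρ : Continuous ρ) (S b : ℕ) {β : ℝ} (hβ : 0 ≤ β) :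
    (0 : QuasiLocalGaugePerturbation 4 (2 * S + 1) G b).IsReflectionPositive ρ β := by
  rcases Nat.eq_zero_or_pos S with rfl | hS
  · exact isReflectionPositive_zero_one ρ hρ β b
  · exact isReflectionPositive_zero_odd ρ hS hρ hβ b

end OddRP

/-! ## §2 Reflection positivity (h2) of the two global witnesses and their connected correlations -/

section RP

variable {G : Type} [Group G] [TopologicalSpace G] [IsTopologicalGroup G] [CompactSpace G]
  [MeasurableSpace G] [BorelSpace G] [SecondCountableTopology G] {N : ℕ}
  {ρ : G →* Matrix (Fin N) (Fin N) ℂ} {hρ : Continuous ρ}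

omit [SecondCountableTopology G] in
/-- Bounded measurable `conj F(ΘU) F(U)` is integrable for every torus Wilson measure. [folklore] -/
theorem integrable_rpObs (hρ : Continuous ρ) {S : ℕ} (β : ℝ)
    (F : GaugeConfig 4 (2 * S + 1) G → ℂ) (hF : Measurable F) {C : ℝ} (hC : ∀ U, ‖F U‖ ≤ C) :
    Integrable (fun U => (starRingEnd ℂ) (F U.timeReflect) * F U)
      (wilsonMeasure (d := 4) (L := 2 * S + 1) ρ β) := by
  haveI := isProbabilityMeasure_wilsonMeasure (d := 4) (L := 2 * S + 1) ρ hρ β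
  refine Integrable.of_bound ?_ (C * C) (Eventually.of_forall fun U => ?_)
  · exact ((Complex.continuous_conj.measurable.comp (hF.comp WilsonRP.measurable_timeReflect)).mul
      hF).aestronglyMeasurable
  · rw [norm_mul, Complex.norm_conj]
    exact mul_le_mul (hC U.timeReflect) (hC U) (norm_nonneg (F U))
      ((norm_nonneg (F U)).trans (hC U))

omit [SecondCountableTopology G] in
/-- A bounded measurable real observable of the periodic lift is integrable. [folklore] -/
theorem integrable_lift (hρ : Continuous ρ) {Lt : ℕ} [NeZero Lt] (β : ℝ)
    {f : GaugeConfig 4 Lt G → ℝ} (hf : Measurable f) {C : ℝ} (hC : ∀ U, |f U| ≤ C) :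
    Integrable f (wilsonMeasure (d := 4) (L := Lt) ρ β) := by
  haveI := isProbabilityMeasure_wilsonMeasure (d := 4) (L := Lt) ρ hρ β
  exact Integrable.of_bound hf.aestronglyMeasurable C
    (Eventually.of_forall fun U => by rw [Real.norm_eq_abs]; exact hC U)

/-- (h2) for case ONE (`β₁ ≥ 0`): the perturbed measure is `μ_{β₁}`, reflection positive on the
odd torus by the tree's Osterwalder–Seiler theorem. [folklore] -/
theorem isReflectionPositive_one (hρ : Continuous ρ) {S : ℕ} (hS : 1 ≤ S) (b : ℕ) (β : ℝ)
    {β₁ : ℝ} (hβ₁ : 0 ≤ β₁) :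
    (globalPert (Lt := 2 * S + 1) ρ hρ b (gOne β β₁) (continuous_gOne β β₁)).IsReflectionPositive
      ρ β := by
  intro F hF hFb hFpos
  unfold QuasiLocalGaugePerturbation.expectation
  rw [perturbedMeasure_one]
  exact wilsonExpectation_oddRP ρ hS hρ hβ₁ F hF hFb hFpos

/-- (h2) for case MIX (`β₁ ≥ 0`): a 50/50 mixture of two reflection-positive measures is
reflection positive. [folklore] -/
theorem isReflectionPositive_mix (hρ : Continuous ρ) {S : ℕ} (hS : 1 ≤ S) (b : ℕ) (β : ℝ)
    {β₁ : ℝ} (hβ₁ : 0 ≤ β₁) :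
    (globalPert (Lt := 2 * S + 1) ρ hρ b
      (gMix β β₁ (partitionFunction (d := 4) (L := 2 * S + 1) ρ β₁).toReal)
      (continuous_gMix β β₁ _ ENNReal.toReal_nonneg)).IsReflectionPositive ρ β := by
  intro F hF hFb hFpos
  obtain ⟨C, hC⟩ := hFb
  rw [expectation_mix b β β₁ _ (integrable_rpObs hρ β₁ F hF hC) (integrable_rpObs hρ 0 F hF hC)]
  have h1 := wilsonExpectation_oddRP ρ hS hρ hβ₁ F hF ⟨C, hC⟩ hFpos
  have h0 := wilsonExpectation_oddRP ρ hS hρ le_rfl F hF ⟨C, hC⟩ hFpos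
  unfold wilsonExpectation at h1 h0
  rw [Complex.real_smul, Complex.real_smul]
  have h2 : (0 : ℂ) ≤ ((2⁻¹ : ℝ) : ℂ) := Complex.zero_le_real.2 (by norm_num)
  exact add_nonneg (mul_nonneg h2 h1) (mul_nonneg h2 h0)

/-- Connected correlations of case ONE are the Wilson ones at `β₁`. [folklore] -/
theorem connectedCorr_one {S : ℕ} (b : ℕ) (β β₁ : ℝ) (A B : LGConfig 4 G → ℝ) (n : ℕ) :
    (globalPert (Lt := 2 * S + 1) ρ hρ b (gOne β β₁) (continuous_gOne β β₁)).connectedCorr ρ β A B n =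
      latticeConnectedCorr ρ β₁ (2 * S + 1) A B n := by
  unfold QuasiLocalGaugePerturbation.connectedCorr QuasiLocalGaugePerturbation.expectation
    latticeConnectedCorr
  rw [perturbedMeasure_one]

/-- Connected correlations of case MIX in terms of Wilson integrals at `β₁` and `0`. [folklore] -/
theorem connectedCorr_mix (hρ : Continuous ρ) {S : ℕ} (b : ℕ) (β β₁ : ℝ) (A B : YMSpecies G) (n : ℕ) :
    (globalPert (Lt := 2 * S + 1) ρ hρ b
      (gMix β β₁ (partitionFunction (d := 4) (L := 2 * S + 1) ρ β₁).toReal)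
      (continuous_gMix β β₁ _ ENNReal.toReal_nonneg)).connectedCorr ρ β A.F B.F n =
    (2⁻¹ * (∫ U, A.F (torusLift (2 * S + 1) U) *
        B.F (configShift (-Pi.single 0 (n : ℤ)) (torusLift (2 * S + 1) U))
          ∂(wilsonMeasure (d := 4) (L := 2 * S + 1) ρ β₁)) +
      2⁻¹ * (∫ U, A.F (torusLift (2 * S + 1) U) *
        B.F (configShift (-Pi.single 0 (n : ℤ)) (torusLift (2 * S + 1) U))
          ∂(wilsonMeasure (d := 4) (L := 2 * S + 1) ρ 0))) -
    (2⁻¹ * (∫ U, A.F (torusLift (2 * S + 1) U) ∂(wilsonMeasure (d := 4) (L := 2 * S + 1) ρ β₁)) +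
      2⁻¹ * (∫ U, A.F (torusLift (2 * S + 1) U) ∂(wilsonMeasure (d := 4) (L := 2 * S + 1) ρ 0))) *
    (2⁻¹ * (∫ U, B.F (torusLift (2 * S + 1) U) ∂(wilsonMeasure (d := 4) (L := 2 * S + 1) ρ β₁)) +
      2⁻¹ * (∫ U, B.F (torusLift (2 * S + 1) U) ∂(wilsonMeasure (d := 4) (L := 2 * S + 1) ρ 0))) := by
  obtain ⟨CA, hCA⟩ := A.bounded
  obtain ⟨CB, hCB⟩ := B.bounded
  have hmA : Measurable fun U : GaugeConfig 4 (2 * S + 1) G => A.F (torusLift (2 * S + 1) U) :=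
    A.measurable.comp (measurable_torusLift _)
  have hmB : Measurable fun U : GaugeConfig 4 (2 * S + 1) G =>
      B.F (configShift (-Pi.single 0 (n : ℤ)) (torusLift (2 * S + 1) U)) :=
    B.measurable.comp ((configShift _).measurable.comp (measurable_torusLift _))
  have hmAB : Measurable fun U : GaugeConfig 4 (2 * S + 1) G => A.F (torusLift (2 * S + 1) U) *
      B.F (configShift (-Pi.single 0 (n : ℤ)) (torusLift (2 * S + 1) U)) := hmA.mul hmB
  have hbAB : ∀ U : GaugeConfig 4 (2 * S + 1) G, |A.F (torusLift (2 * S + 1) U) *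
      B.F (configShift (-Pi.single 0 (n : ℤ)) (torusLift (2 * S + 1) U))| ≤ CA * CB := fun U => by
    rw [abs_mul]
    exact mul_le_mul (hCA _) (hCB _) (abs_nonneg _)
      ((abs_nonneg (A.F (torusLift (2 * S + 1) U))).trans (hCA _))
  have hmB' : Measurable fun U : GaugeConfig 4 (2 * S + 1) G => B.F (torusLift (2 * S + 1) U) :=
    B.measurable.comp (measurable_torusLift _)
  unfold QuasiLocalGaugePerturbation.connectedCorr
  rw [expectation_mix b β β₁ _ (integrable_lift hρ β₁ hmAB hbAB) (integrable_lift hρ 0 hmAB hbAB),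
    expectation_mix b β β₁ _ (integrable_lift hρ β₁ hmA (fun U => hCA _))
      (integrable_lift hρ 0 hmA (fun U => hCA _)),
    expectation_mix b β β₁ _ (integrable_lift hρ β₁ hmB' (fun U => hCB _))
      (integrable_lift hρ 0 hmB' (fun U => hCB _))]
  simp only [smul_eq_mul]

end RP

/-! ## §3 `G = SU(3)`, fundamental representation: the plaquette species and its means -/

section SU3

/-- The gauge group `SU(3)` of the crux. [folklore] -/
abbrev SU3 : Type := ↥(Matrix.specialUnitaryGroup (Fin 3) ℂ)

/-- The fundamental representation of `SU(3)` (the crux's `ρ`). [folklore] -/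
abbrev ρ₃ : SU3 →* Matrix (Fin 3) (Fin 3) ℂ := fundamentalRep (Fin 3)

/-- The fundamental representation is continuous. [folklore] -/
theorem continuous_ρ₃ : Continuous ρ₃ := continuous_fundamentalRep _

/-- The plaquette species in the `(0,1)` plane at the origin (`Re tr U_p`, tree
`plaquetteObservable`). [folklore] -/
def P01 : YMSpecies SU3 := plaquetteObservable (d := 4) ρ₃ continuous_ρ₃ 0 1

/-- The underlying function of `P01`. [folklore] -/
theorem P01_F (V : LGConfig 4 SU3) : P01.F V = (ρ₃ (plaquetteHolonomyZd V 0 0 1)).trace.re := rfl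

/-- The support of `P01`: the four links of the plaquette. [folklore] -/
theorem P01_supp : P01.supp = originPlaquetteSupport (d := 4) 0 1 := rfl

/-- On periodic lifts the species reads the torus plaquette at the origin. [folklore] -/
theorem P01_torusLift {Lt : ℕ} [NeZero Lt] (U : GaugeConfig 4 Lt SU3) :
    P01.F (torusLift Lt U) = (ρ₃ (plaquetteHolonomy U 0 0 1)).trace.re := by
  rw [P01_F]
  have h : plaquetteHolonomyZd (torusLift Lt U) 0 0 1 = plaquetteHolonomy U 0 0 1 := by
    have h0 : Literature.Probability.LatticeModels.Torus.proj Lt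
        (0 : Literature.Probability.LatticeModels.Site 4) = (0 : Site 4 Lt) := by
      funext k; simp [Literature.Probability.LatticeModels.Torus.proj]
    rw [← h0]
    exact plaquette_torusLift Lt U 0 0 1
  rw [h]

/-- ... equivalently `3 ×` the normalised `1 × 1` Wilson loop. [folklore] -/
theorem P01_torusLift_eq_wilsonLoop {Lt : ℕ} [NeZero Lt] (U : GaugeConfig 4 Lt SU3) :
    P01.F (torusLift Lt U) = 3 * wilsonLoop ρ₃ (0 : Site 4 Lt) 0 1 1 1 U := by
  rw [P01_torusLift, wilsonLoop, rectangleHolonomy_one_one]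
  ring

/-- The links of `P01` have time coordinate in `[-1, 1]`. [folklore] -/
theorem P01_supp_time : ∀ e ∈ P01.supp, |e.1 0| ≤ ((1 : ℕ) : ℤ) := by
  intro e he
  rw [P01_supp, originPlaquetteSupport] at he
  simp only [Finset.mem_insert, Finset.mem_singleton] at he
  rcases he with rfl | rfl | rfl | rfl <;> simp

/-- The links of `P01` are based in the cube `{-1,0,1}^4`. [folklore] -/
theorem P01_supp_box : ∀ e ∈ P01.supp, e.1 ∈ Literature.Probability.LatticeModels.box 4 1 := by
  intro e he
  rw [P01_supp, originPlaquetteSupport] at he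
  simp only [Finset.mem_insert, Finset.mem_singleton] at he
  rw [Literature.Probability.LatticeModels.mem_box]
  intro i
  rcases he with rfl | rfl | rfl | rfl
  · simp
  · by_cases hi : i = 0
    · subst hi; simp
    · simp [hi]
  · by_cases hi : i = 1
    · subst hi; simp
    · simp [hi]
  · simp

/-- At `β = 0` the plaquette has mean zero (centre twist, tree `integral_reTr_eq_zero`). [folklore] -/
theorem integral_P01_zero {S : ℕ} (hS : 1 ≤ S) :
    ∫ U, P01.F (torusLift (2 * S + 1) U) ∂(wilsonMeasure (d := 4) (L := 2 * S + 1) ρ₃ 0) = 0 := by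
  rw [wilsonMeasure_zero_eq_pi]
  have hinj : Set.InjOn (torusEdge (d := 4) (2 * S + 1)) ↑P01.supp :=
    torusEdge_injOn (n := 1) (L := 2 * S) (by omega) fun e he => P01_supp_box e he
  have hdep : DependsOn P01.F (↑P01.supp : Set (Literature.MathematicalPhysics.QuantumLattice.ZdEdge 4)) :=
    P01.isCylinder
  rw [integral_torusLift_eq_integral_zdHaar hinj P01.measurable hdep]
  have : (fun U : ZdGaugeConfig 4 SU3 => P01.F U) =
      fun U => PlaquetteLowerBound.reTr ρ₃ (ZdGaugeConfig.plaquette U 0 0 1) := rfl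
  rw [this, PlaquetteLowerBound.integral_comp_plaquette_eq (PlaquetteLowerBound.continuous_reTr ρ₃
    continuous_ρ₃) 0 (by decide)]
  exact PlaquetteLowerBound.integral_reTr_eq_zero ρ₃ (TorusAreaLaw.isSpecialUnitaryModel_fundamentalRep 3) (by norm_num)

/-- **Strong-coupling lower bound, uniform in the volume** (tree `wilsonExpectation_plaquette_ge`,
first order of the cluster expansion): there are `β₁ > 0` and `m₀ > 0` with
`⟨Re tr U_p⟩_{2S+1, β₁} ≥ m₀` for all `S ≥ 1`. [folklore] -/
theorem exists_plaquette_mean_lower_bound :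
    ∃ β₁ : ℝ, 0 < β₁ ∧ ∃ m₀ : ℝ, 0 < m₀ ∧ ∀ S : ℕ, 1 ≤ S →
      m₀ ≤ ∫ U, P01.F (torusLift (2 * S + 1) U) ∂(wilsonMeasure (d := 4) (L := 2 * S + 1) ρ₃ β₁) := by
  have hSU := TorusAreaLaw.isSpecialUnitaryModel_fundamentalRep 3
  have hb1 : 0 < betaOne 4 ρ₃ := betaOne_pos 4 (ρ := ρ₃)
  have hV : 0 < PlaquetteLowerBound.charVariance ρ₃ :=
    PlaquetteLowerBound.charVariance_pos ρ₃ continuous_ρ₃ (by norm_num)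
  obtain ⟨Kc, hKc⟩ : ∃ Kc : ℝ, Kc = (2 * Real.exp (1 / 2)) ^ (4 * (2 ^ 4 * (4 * 4))) := ⟨_, rfl⟩
  have hKc0 : 0 < Kc := by rw [hKc]; positivity
  obtain ⟨A, hA⟩ : ∃ A : ℝ, A = (3 : ℝ)⁻¹ * PlaquetteLowerBound.charVariance ρ₃ * Real.exp (-1) :=
    ⟨_, rfl⟩
  have hA0 : 0 < A := by rw [hA]; positivity
  obtain ⟨B, hB⟩ : ∃ B : ℝ, B = A * betaOne 4 ρ₃ ^ 2 / (2 * Kc) := ⟨_, rfl⟩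
  have hB0 : 0 < B := by rw [hB]; positivity
  set β : ℝ := min (betaOne 4 ρ₃) (min (1 / (2 * 3)) B) with hβdef
  have hβ0 : 0 < β := lt_min hb1 (lt_min (by norm_num) hB0)
  have hβ1 : β ≤ betaOne 4 ρ₃ := min_le_left _ _
  have hβN : β ≤ 1 / (2 * 3) := (min_le_right _ _).trans (min_le_left _ _)
  have hβB : β ≤ B := (min_le_right _ _).trans (min_le_right _ _)
  refine ⟨β, hβ0, 3 * (A / 2 * β), by positivity, fun S hS => ?_⟩
  have key := PlaquetteLowerBound.wilsonExpectation_plaquette_ge ρ₃ hSU (by norm_num)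
    (show (0 : Fin 4) ≠ 1 by decide) (L := 2 * S) (by omega) hβ0.le hβ1
  have hint : ∫ U, P01.F (torusLift (2 * S + 1) U) ∂(wilsonMeasure (d := 4) (L := 2 * S + 1) ρ₃ β) =
      3 * wilsonExpectation (d := 4) (L := 2 * S + 1) ρ₃ β (wilsonLoop ρ₃ (0 : Site 4 (2 * S + 1)) 0 1 1 1) := by
    unfold wilsonExpectation
    rw [← integral_const_mul]
    refine integral_congr_ae (Eventually.of_forall fun U => ?_)
    exact P01_torusLift_eq_wilsonLoop U
  rw [hint]
  refine mul_le_mul_of_nonneg_left (le_trans ?_ key) (by norm_num)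
  rw [← hKc]
  have h1 : Real.exp (-1) ≤ Real.exp (-(2 * β * (3 : ℕ))) := by
    refine Real.exp_le_exp.2 ?_
    have : β * (2 * 3) ≤ 1 := by rwa [le_div_iff₀ (by positivity)] at hβN
    push_cast
    linarith
  have h2 : Kc * (β / betaOne 4 ρ₃) ^ 2 ≤ A / 2 * β := by
    have e : Kc * (β / betaOne 4 ρ₃) ^ 2 = Kc / betaOne 4 ρ₃ ^ 2 * β * β := by
      field_simp
    rw [e]
    refine mul_le_mul_of_nonneg_right ?_ hβ0.le
    calc Kc / betaOne 4 ρ₃ ^ 2 * β ≤ Kc / betaOne 4 ρ₃ ^ 2 * B :=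
          mul_le_mul_of_nonneg_left hβB (by positivity)
      _ = A / 2 := by rw [hB]; field_simp
  have h3 : A * β ≤ ((3 : ℕ) : ℝ)⁻¹ * (β * Real.exp (-(2 * β * (3 : ℕ))) *
      PlaquetteLowerBound.charVariance ρ₃) := by
    have e : ((3 : ℕ) : ℝ)⁻¹ * (β * Real.exp (-(2 * β * (3 : ℕ))) * PlaquetteLowerBound.charVariance ρ₃) =
        (3 : ℝ)⁻¹ * PlaquetteLowerBound.charVariance ρ₃ * Real.exp (-(2 * β * (3 : ℕ))) * β := by
      push_cast; ring
    rw [e, hA]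
    refine mul_le_mul_of_nonneg_right ?_ hβ0.le
    exact mul_le_mul_of_nonneg_left h1 (by positivity)
  linarith

end SU3

end Summit.QuantumFields.QCD.Theorems.RobustYangMills.Negative
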